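import Summits.CriticalPhenomena.CardyFormulaZ2.Theorems.CardyBoundaryCoulombGasBoundaryDefectGaussianRStubRealisabilityPart26

/-!
# Stub `stub_realisability` of line `rainbow-monomials-in-excursion-kernels` — Part 27:
# strand ends of the collar walk (VI): which ends are cuts — starts follow cuts (E2), two ends
# with one tag are not both cuts (E3)
# (crux `BoundaryDefectGaussianR`, stmt-CriticalPhenomena-14132; insertion dictionary D2, layer 3b)

The four kinds of ends at an active rail dart `ds[t] = (c, K)` (levels `ℓ → ℓ'`, ghost
`g = c + dir K`) and their turns in the completed configuration of `∅`:

* JUMP (`ℓ' = ℓ ± 2`, free both sides): the FINISH `(c, K + 3)` IS a cut — the jump edge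
  `{c, g}` is closed (`c` is a free vertex, not a spoke: `se_jump_target_closed`) and the two
  collar faces it separates are two levels apart (`se_isCut_jump_finish`); its successor is the
  START `(c, K)`, NOT a cut (live target `{c, c + dir (K+1)}`, `se_not_isCut_jump_start`);
* junction CLOSING the arc (`c` arc vertex, wired before): the end `(g, K + 1)` is NOT a cut —
  it follows the open spoke `{g, c}` to `(c, K)`, both tracked, ghost and arc vertex at the same
  wired level (`se_not_isCut_closing`, with `se_arc_vertH`, `se_ghost_vertH_close`); it is the
  successor of the cut `(g, K)` (Part 26);
* junction OPENING the arc (free before): the end `(g, K + 2)` IS a cut — the edge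
  `{g, g - dir (K+1)}` is closed and leads to the untracked outer corner `(g, K + 3)`
  (`se_isCut_opening`).

Hence (`se_end_cut_cases`): an end that is not a cut is the successor of a cut (E2,
`se_start_main`, registered `s14_strandEnds_start`), and a cut end was created on a FREE stretch
(`ℓ` even, `st_wired_iff_odd`), so its tag is even in the rising phase and odd in the falling
phase; two distinct ends with the same tag come one from each phase (Part 22), so they are not
both cuts (E3, `se_types_main`, registered `s14_strandEnds_types`). All [folklore].
-/

namespace Summit.CriticalPhenomena.CardyFormulaZ2.Cruxes.BoundaryDefectGaussianR.RainbowMonomialsInExcursionKernels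

open Literature.Probability.LatticeModels Literature.Probability.LatticeModels.CollarLegModel

section Cuts

variable (ι : LegInsertionData) (V : Finset (ℤ × ℤ)) {d₀ : Dart} (hadm : ι.IsAdmissible V)
  (h : outDart V ι.sink = some d₀) {st : ℕ → WalkState}
  (hst : ∀ t, st t = List.foldl (fun s d => s.step (ι.startAt V d)) ι.init ((cycle V d₀).take t))
  {t : ℕ} (ht : t < (cycle V d₀).length) {c : ℤ × ℤ} {K : Fin 4}
  (hch : ∀ s t : ℤ, -2 ≤ s → s ≤ 2 → -2 ≤ t → t ≤ 2 → (c + s • dir (K + 1) + t • dir K ∈ V ↔ t ≤ 0))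
  (hchp : ∀ s t : ℤ, -2 ≤ s → s ≤ 2 → -2 ≤ t → t ≤ 2 →
    (c - dir (K + 1) + s • dir (K + 1) + t • dir K ∈ V ↔ t ≤ 0))
  (hds : (cycle V d₀)[t] = (c, K))
  (hpred1 : ∀ (h1 : 1 ≤ t), (cycle V d₀)[t - 1] = (c - dir (K + 1), K))
  (hpred0 : t = 0 → (cycle V d₀)[(cycle V d₀).length - 1]'(by omega) = (c - dir (K + 1), K))

include hadm h hst ht hch hds in
/-- **The turn across a jump edge is closed in `cfgOf ∅`** (the jump edge `{c, c + dir K}` at a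
free vertex is not a spoke). [folklore] -/
theorem se_jump_target_closed (hw0 : (st t).wired = false) (hw1 : (st (t + 1)).wired = false) :
    cTgt (toSite c, K + 3) ∉ (ι.model V).cfgOf ∅ := by
  obtain ⟨hcV, hcK, -⟩ := se_rail_local hch
  obtain ⟨e, hc, hend⟩ := se_corner_edge c (K + 3)
  rw [(tp_fin4 K).2.2.1] at hend
  rw [se_cTgt_mem_cfgOf_iff _ _ hc]
  rintro (hm | ho)
  · simp at hm
  have hfree := se_jump_vertex_free ι V hadm h hst ht hch hds hw0 hw1
  rw [mem_freeCells_false, freeVerts, Finset.mem_sdiff] at hfree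
  have hV : e.1 ∈ (ι.model V).V ∨ SixVertex.edgeTip e ∈ (ι.model V).V := by
    rcases hend with ⟨h1, -⟩ | ⟨-, h2⟩
    · exact Or.inl (h1 ▸ hcV)
    · exact Or.inr (h2 ▸ hcV)
  rcases se_openEdges_arc _ ho hV with ha | ha <;> rcases hend with ⟨h1, h2⟩ | ⟨h1, h2⟩
  · rw [h1] at ha; exact hfree.2 (Finset.mem_inter.1 ha).1
  · rw [h1] at ha; exact hcK (Finset.mem_inter.1 ha).2
  · rw [h2] at ha; exact hcK (Finset.mem_inter.1 ha).2
  · rw [h2] at ha; exact hfree.2 (Finset.mem_inter.1 ha).1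

include hadm h hst ht hch hchp hds hpred1 hpred0 in
/-- **The finish of a jump edge is a cut**: at the corner `(c, K + 3)` (in the face before) the
level line would have to cross the closed jump edge into the face after, two levels away — an
inconsistent frozen turn; its successor in `cfgOf ∅` is the start `(c, K)`. [folklore] -/
theorem se_isCut_jump_finish (hj : (st (t + 1)).level = (st t).level + 2 ∨ (st t).level = (st (t + 1)).level + 2)
    (hw0 : (st t).wired = false) (hw1 : (st (t + 1)).wired = false) :
    (ι.model V).IsCut (toSite c, K + 3) ∧
      nextCorner ((ι.model V).cfgOf ∅) (toSite c, K + 3) = (toSite c, K) := by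
  obtain ⟨hcV, hcK, -⟩ := se_rail_local hch
  have hclosed := se_jump_target_closed ι V hadm h hst ht hch hds hw0 hw1
  have hnext : nextCorner ((ι.model V).cfgOf ∅) (toSite c, K + 3) = (toSite c, K) := by
    rw [nextCorner_of_not_mem hclosed, (tp_fin4 K).2.2.1]
  refine ⟨⟨fun hl => hcK ?_, fun hcons => ?_⟩, hnext⟩
  · have := ((se_targetsLive_iff _ _ _).1 hl).2
    rwa [(tp_fin4 K).2.2.1] at this
  · have heq := hcons.2.2.2 hclosed
    rw [hnext] at heq
    obtain ⟨gf1, -, gf3, -⟩ := se_gapFace_eq_cFace c K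
    rw [← gf1, ← gf3, hf_of_not_mem _ _ (se_collar_face_after ι V hadm h hst ht hch hds hw1).2.1,
      hf_of_not_mem _ _ (se_collar_face_before ι V hadm h hst ht hch hchp hpred1 hpred0 hw0).2.1] at heq
    change (ι.collar V).faceH _ = (ι.collar V).faceH _ at heq
    rw [(se_collar_face_after ι V hadm h hst ht hch hds hw1).2.2,
      (se_collar_face_before ι V hadm h hst ht hch hchp hpred1 hpred0 hw0).2.2] at heq
    omega

include hch in
/-- **The start of a jump edge is not a cut**: the corner `(c, K)` targets the live boundary edge
`{c, c + dir (K+1)}`. [folklore] -/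
theorem se_not_isCut_jump_start : ¬(ι.model V).IsCut (toSite c, K) := by
  obtain ⟨hcV, -, -⟩ := se_rail_local hch
  intro hcut
  refine hcut.1 ((se_targetsLive_iff _ _ _).2 ⟨hcV, ?_⟩)
  have e1 : c + dir (K + 1) = c + (1 : ℤ) • dir (K + 1) + (0 : ℤ) • dir K := by module
  show c + dir (K + 1) ∈ V
  rw [e1]; exact (hch 1 0 (by norm_num) (by norm_num) (by norm_num) (by norm_num)).2 le_rfl

include hadm h hst ht hch hds hpred1 in
/-- **The end at a junction closing the arc is not a cut**: the corner `(g, K + 1)` at the ghost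
follows the open spoke `{g, c}` to `(c, K)`, both tracked, and ghost and arc vertex carry the
same (wired) level. [folklore] -/
theorem se_not_isCut_closing (hw : (st t).wired = true) (hw1 : (st (t + 1)).wired = false) :
    ¬(ι.model V).IsCut (toSite (c + dir K), K + 1) := by
  obtain ⟨hcV, hcK, -⟩ := se_rail_local hch
  intro hcut
  apply hcut.2
  obtain ⟨harcV, hgh⟩ := se_arc_and_ghost ι V h hst ht hch hds (Or.inl hw)
  have hcVC : c ∈ (ι.model V).vertexCells := Finset.mem_union_left _ hcV
  have hgVC : c + dir K ∈ (ι.model V).vertexCells := Finset.mem_union_right _ hgh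
  obtain ⟨e, hc, hend⟩ := se_corner_edge (c + dir K) (K + 1)
  have hKK : c + dir K + dir (K + 1 + 1) = c := by rw [(tp_fin4 K).1, tp_dir_add_two]; abel
  rw [hKK] at hend
  -- the spoke is frozen open
  have hopen : cTgt (toSite (c + dir K), K + 1) ∈ (ι.model V).cfgOf ∅ := by
    rw [se_cTgt_mem_cfgOf_iff _ _ hc]
    right
    have hfr : e ∈ (ι.model V).frozenEdges := by
      rw [frozenEdges, Finset.mem_sdiff, SixVertex.mem_edges_iff, E, inducedEdges, Finset.mem_filter]
      rcases hend with ⟨h1, h2⟩ | ⟨h1, h2⟩ <;> rw [h1, h2]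
      · exact ⟨Or.inr hcVC, fun hh => hcK hh.2.1⟩
      · exact ⟨Or.inl hcVC, fun hh => hcK hh.2.2⟩
    rw [openEdges, Finset.mem_filter]
    refine ⟨hfr, ?_⟩
    rcases hend with ⟨h1, h2⟩ | ⟨h1, h2⟩ <;> rw [h1, h2]
    · exact Or.inr (Or.inl ⟨harcV, hgh⟩)
    · exact Or.inl ⟨harcV, hgh⟩
  have hnext : nextCorner ((ι.model V).cfgOf ∅) (toSite (c + dir K), K + 1) = (toSite c, K) := by
    have hKK2 : c + dir K + dir (K + 2) = c := by rw [tp_dir_add_two]; abel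
    rw [nextCorner_of_mem hopen, (tp_fin4 K).1, (tp_fin4 K).2.2.2.2.1, ← se_toSite_add_dir, hKK2]
  obtain ⟨gf1, gf2, -, -⟩ := se_gapFace_eq_cFace c K
  obtain ⟨hfa1, -, -⟩ := se_collar_face_after ι V hadm h hst ht hch hds hw1
  refine ⟨⟨by simpa using hgVC, by rw [← gf2]; exact hfa1⟩, ?_, fun _ => ?_, fun hn => absurd hopen hn⟩
  · rw [hnext]; exact ⟨by simpa using hcVC, by rw [← gf1]; exact hfa1⟩
  · rw [hnext]
    simp only [ofSite_toSite]
    obtain ⟨hcf, hvc⟩ := se_arc_vertH ι V hadm h hst ht hch hds hw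
    obtain ⟨-, hgf⟩ := se_ghost_cell ι V h hst ht hch hds (Or.inl hw)
    rw [hv_of_not_mem _ _ hgf, hv_of_not_mem _ _ hcf]
    change (ι.collar V).vertH _ = (ι.collar V).vertH _
    rw [hvc, se_ghost_vertH_close ι V hadm h hst ht hch hds hpred1 hw]

include hadm h hst ht hch hds hpred1 hpred0 in
/-- **The end at a junction opening the arc is a cut**: the corner `(g, K + 2)` at the ghost (in
the face before, the stretch before being free) crosses the closed edge `{g, g - dir (K+1)}` to the
untracked outer corner `(g, K + 3)`. [folklore] -/
theorem se_isCut_opening (hw : (st t).wired = false) :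
    (ι.model V).IsCut (toSite (c + dir K), K + 2) := by
  obtain ⟨hcV, hcK, -⟩ := se_rail_local hch
  refine ⟨fun hl => hcK ((se_targetsLive_iff _ _ _).1 hl).1, fun hcons => ?_⟩
  have hclosed : cTgt (toSite (c + dir K), K + 2) ∉ (ι.model V).cfgOf ∅ := by
    obtain ⟨e, hc, hend⟩ := se_corner_edge (c + dir K) (K + 2)
    rw [(tp_fin4 K).2.1, tp_dir_add_three] at hend
    rw [se_cTgt_mem_cfgOf_iff _ _ hc]
    rintro (hm | ho)
    · simp at hm
    have hg' : c + dir K + -dir (K + 1) ∉ V := by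
      have e1 : c + dir K + -dir (K + 1) = c + (-1 : ℤ) • dir (K + 1) + (1 : ℤ) • dir K := by module
      rw [e1]; intro hm
      have := (hch (-1) 1 (by norm_num) (by norm_num) (by norm_num) (by norm_num)).1 hm
      omega
    rcases se_ghost_edge_open ι V hadm h hst ht hch hds hpred1 hpred0 ho hend hg' with ⟨-, hcor⟩ | ⟨hw', -⟩
    · rw [se_faceCorners_gapFace] at hcor
      have g0 : c + dir K + -dir (K + 1) = c + (-1 : ℤ) • dir (K + 1) + (1 : ℤ) • dir K := by module
      obtain ⟨e0, e1, -, -⟩ := se_dir_frame K c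
      have e4 : c + dir K + dir (K + 1) = c + (1 : ℤ) • dir (K + 1) + (1 : ℤ) • dir K := by module
      have e00 : c = c + (0 : ℤ) • dir (K + 1) + (0 : ℤ) • dir K := by module
      simp only [Finset.mem_insert, Finset.mem_singleton] at hcor
      rcases hcor with hq | hq | hq | hq
      · rw [g0] at hq; conv_rhs at hq => rw [e00]
        rw [se_frame_inj] at hq; omega
      · rw [g0, e1, se_frame_inj] at hq; omega
      · rw [g0, e0, se_frame_inj] at hq; omega
      · rw [g0, e4, se_frame_inj] at hq; omega
    · rw [hw] at hw'; exact Bool.false_ne_true hw'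
  have hnext : nextCorner ((ι.model V).cfgOf ∅) (toSite (c + dir K), K + 2) = (toSite (c + dir K), K + 3) := by
    rw [nextCorner_of_not_mem hclosed, (tp_fin4 K).2.1]
  have htr := hcons.2.1
  rw [hnext] at htr
  exact (se_ghost_outer_faces ι V hch).2 htr.2

end Cuts
/-! ## Part F: starts follow cuts; the parity of finishes; registered forms (E2), (E3) -/

section Types

variable (ι : LegInsertionData) (V : Finset (ℤ × ℤ)) {d₀ : Dart} (hadm : ι.IsAdmissible V)
  (h : outDart V ι.sink = some d₀) {st : ℕ → WalkState}
  (hst : ∀ t, st t = List.foldl (fun s d => s.step (ι.startAt V d)) ι.init ((cycle V d₀).take t))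

include hadm h hst in
/-- **Cuts among the ends of one dart, and the parity of their tags.** At an active rail dart with
levels `ℓ → ℓ'`: an end whose corner is a cut is the finish of a jump edge or the end of a
junction opening the arc, created on a FREE stretch (`ℓ` even); so its tag is even if the level
rises and odd if it falls. An end that is not a cut is the successor of a cut turn. [folklore] -/
theorem se_end_cut_cases
    (hflat : ∀ x ∈ insert ι.sink ι.source, ∃ d : ℤ × ℤ, (d = (1, 0) ∨ d = (-1, 0) ∨ d = (0, 1) ∨ d = (0, -1)) ∧
      ∀ v : ℤ × ℤ, (v.1 - x.1) ^ 2 + (v.2 - x.2) ^ 2 ≤ ((ι.sinkLegs : ℤ) + 3) ^ 2 →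
        (v ∈ V ↔ 0 ≤ (v.1 - x.1) * d.1 + (v.2 - x.2) * d.2))
    {t : ℕ} (ht : t < (cycle V d₀).length) {e : (Site 2 × Fin 4) × ℤ}
    (he : e ∈ LegInsertionData.endsAt ((cycle V d₀)[t], st t, st (t + 1))) :
    ((ι.model V).IsCut e.1 → ((st t).level < (st (t + 1)).level → e.2 % 2 = 0) ∧
      ((st (t + 1)).level < (st t).level → e.2 % 2 = 1)) ∧
    (¬(ι.model V).IsCut e.1 → ∃ c, (ι.model V).IsCut c ∧ nextCorner ((ι.model V).cfgOf ∅) c = e.1) := by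
  have hact : (st (t + 1)).level ≠ (st t).level := fun h0 => by
    rw [se_endsAt_nil _ _ _ h0] at he; simp at he
  obtain ⟨c, K, hch, hchp, hds, hpred1, hpred0⟩ := se_active_rail ι V hadm h hst hflat ht hact
  obtain ⟨hΔ, hjw, hnjw⟩ := se_active_delta ι V hst ht hact
  have hpar := st_wired_iff_odd ι V hadm h hst (t := t) ht.le
  rw [hds] at he
  rcases se_endsAt_site _ _ _ he with ⟨hj, hE⟩ | ⟨hnj, -, hE⟩
  · obtain ⟨hw0, hw1⟩ := hjw hj
    obtain ⟨hcutF, hnextF⟩ := se_isCut_jump_finish ι V hadm h hst ht hch hchp hds hpred1 hpred0 hj hw0 hw1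
    have heven : ¬ (st t).level % 2 = 1 := fun h1 => by rw [← hpar] at h1; rw [hw0] at h1; exact Bool.false_ne_true h1
    rcases hE with rfl | rfl
    · refine ⟨fun _ => ⟨fun hlt => ?_, fun hlt => ?_⟩, fun hn => absurd hcutF hn⟩ <;> simp only <;> omega
    · exact ⟨fun hc => absurd hc (se_not_isCut_jump_start ι V hch), fun _ => ⟨_, hcutF, hnextF⟩⟩
  · have hw' := hnjw hnj
    have h1 : (st (t + 1)).level = (st t).level + 1 ∨ (st (t + 1)).level = (st t).level - 1 := by
      rcases hΔ with hd | hd | hd | hd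
      · exact Or.inl hd
      · exact Or.inr hd
      · exact absurd (Or.inl hd) hnj
      · exact absurd (Or.inr (by omega)) hnj
    rcases hE with ⟨hw, rfl⟩ | ⟨hw, rfl⟩
    · rw [hw] at hw'
      have hnc := se_not_isCut_closing ι V hadm h hst ht hch hds hpred1 hw (by simpa using hw')
      refine ⟨fun hc => absurd hc hnc, fun _ => ⟨(toSite (c + dir K), K), se_isCut_ghost_out ι V hch, ?_⟩⟩
      exact se_next_ghost_out ι V hadm h hst ht hch hds hpred1 hpred0 (by simpa using hw')
    · have hcutO := se_isCut_opening ι V hadm h hst ht hch hds hpred1 hpred0 hw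
      have heven : ¬ (st t).level % 2 = 1 := fun h1 => by rw [← hpar] at h1; rw [hw] at h1; exact Bool.false_ne_true h1
      refine ⟨fun _ => ⟨fun hlt => ?_, fun hlt => ?_⟩, fun hn => absurd hcutO hn⟩ <;> simp only <;> omega

include hadm h hst in
/-- **(E2) for the registered ends**: an end that is not a cut is the successor, in the completed
configuration of `∅`, of a cut turn (positional form of `s14_strandEnds_start`). [folklore] -/
theorem se_start_main
    (hflat : ∀ x ∈ insert ι.sink ι.source, ∃ d : ℤ × ℤ, (d = (1, 0) ∨ d = (-1, 0) ∨ d = (0, 1) ∨ d = (0, -1)) ∧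
      ∀ v : ℤ × ℤ, (v.1 - x.1) ^ 2 + (v.2 - x.2) ^ 2 ≤ ((ι.sinkLegs : ℤ) + 3) ^ 2 →
        (v ∈ V ↔ 0 ≤ (v.1 - x.1) * d.1 + (v.2 - x.2) * d.2))
    {e : (Site 2 × Fin 4) × ℤ} (he : e ∈ ι.strandEnds V)
    (hn : ¬(ι.model V).IsCut e.1) : ∃ c, (ι.model V).IsCut c ∧ nextCorner ((ι.model V).cfgOf ∅) c = e.1 := by
  obtain ⟨t, ht, hte⟩ := (se_mem_strandEnds_iff ι V h hst).1 he
  exact (se_end_cut_cases ι V hadm h hst hflat ht hte).2 hn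

include hadm h hst in
/-- **(E3) for the registered ends**: two distinct ends with the same tag are not both cuts — one
was created in the rising phase, the other in the falling phase, and the tag of a cut end is even
in the first case and odd in the second (positional form of `s14_strandEnds_types`). [folklore] -/
theorem se_types_main
    (hflat : ∀ x ∈ insert ι.sink ι.source, ∃ d : ℤ × ℤ, (d = (1, 0) ∨ d = (-1, 0) ∨ d = (0, 1) ∨ d = (0, -1)) ∧
      ∀ v : ℤ × ℤ, (v.1 - x.1) ^ 2 + (v.2 - x.2) ^ 2 ≤ ((ι.sinkLegs : ℤ) + 3) ^ 2 →
        (v ∈ V ↔ 0 ≤ (v.1 - x.1) * d.1 + (v.2 - x.2) * d.2))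
    {e e' : (Site 2 × Fin 4) × ℤ} (he : e ∈ ι.strandEnds V)
    (he' : e' ∈ ι.strandEnds V) (htag : e.2 = e'.2) (hne : e.1 ≠ e'.1) :
    ¬((ι.model V).IsCut e.1 ∧ (ι.model V).IsCut e'.1) := by
  rintro ⟨hcut, hcut'⟩
  obtain ⟨t, ht, hte⟩ := (se_mem_strandEnds_iff ι V h hst).1 he
  obtain ⟨t', ht', hte'⟩ := (se_mem_strandEnds_iff ι V h hst).1 he'
  obtain ⟨hpe, -⟩ := se_end_cut_cases ι V hadm h hst hflat ht hte
  obtain ⟨hpe', -⟩ := se_end_cut_cases ι V hadm h hst hflat ht' hte'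
  have htg := se_endsAt_tag _ _ _ hte
  have htg' := se_endsAt_tag _ _ _ hte'
  have hact : (st (t + 1)).level ≠ (st t).level := fun h0 => by
    rw [se_endsAt_nil _ _ _ h0] at hte; simp at hte
  have hact' : (st (t' + 1)).level ≠ (st t').level := fun h0 => by
    rw [se_endsAt_nil _ _ _ h0] at hte'; simp at hte'
  obtain ⟨T₀, -, hTP, -, hup, hdown⟩ := se_phases ι V hadm h hst
  have hmu := se_mono_up (fun t => (st t).level) T₀ hup
  have hmd := se_mono_down (fun t => (st t).level) T₀ (cycle V d₀).length hdown
  -- rising / falling at `t` and `t'`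
  have hrise : ∀ u, u < (cycle V d₀).length → (st (u + 1)).level ≠ (st u).level →
      (u < T₀ → (st u).level < (st (u + 1)).level) ∧ (T₀ ≤ u → (st (u + 1)).level < (st u).level) :=
    fun u hu hau => ⟨fun h1 => hup u h1, fun h1 => lt_of_le_of_ne (hdown u h1 hu) hau⟩
  obtain ⟨hr, hf⟩ := hrise t ht hact
  obtain ⟨hr', hf'⟩ := hrise t' ht' hact'
  by_cases htT : t < T₀ <;> by_cases htT' : t' < T₀
  · -- both rising: same dart, same tag, same end
    have hl := hr htT
    have hl' := hr' htT'
    rw [min_eq_left hl.le, max_eq_right hl.le] at htg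
    rw [min_eq_left hl'.le, max_eq_right hl'.le] at htg'
    have htt : t = t' := by
      by_contra hne'
      rcases lt_or_gt_of_ne hne' with hlt' | hgt
      · have := hmu (t + 1) t' hlt' htT'.le; omega
      · have := hmu (t' + 1) t hgt htT.le; omega
    subst htt
    exact hne (congrArg Prod.fst ((se_endsAt_inj _ _ _ hte hte').1 htag))
  · have h1 := (hpe hcut).1 (hr htT)
    have h2 := (hpe' hcut').2 (hf' (not_lt.1 htT'))
    omega
  · have h1 := (hpe hcut).2 (hf (not_lt.1 htT))
    have h2 := (hpe' hcut').1 (hr' htT')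
    omega
  · have hl := hf (not_lt.1 htT)
    have hl' := hf' (not_lt.1 htT')
    rw [min_eq_right hl.le, max_eq_left hl.le] at htg
    rw [min_eq_right hl'.le, max_eq_left hl'.le] at htg'
    have htt : t = t' := by
      by_contra hne'
      rcases lt_or_gt_of_ne hne' with hlt' | hgt
      · have := hmd (t + 1) t' (by omega) (by omega) ht'.le; omega
      · have := hmd (t' + 1) t (by omega) (by omega) ht.le; omega
    subst htt
    exact hne (congrArg Prod.fst ((se_endsAt_inj _ _ _ hte hte').1 htag))

end Types

/-- **Sub-goal `s14_strandEnds_start`** (registered on stmt-CriticalPhenomena-14132; hypothesis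
(E2) of `s14_rainbow_of_valid`): for an admissible leg insertion with flat insertion points, a
strand end whose corner is not a cut is the successor, in the completed configuration of no live
edge, of a cut turn: the start `(v, k)` of a jump edge follows the finish `(v, k + 3)`, the end
`(g, k + 1)` of a junction closing the arc follows the untracked outer corner `(g, k)` of the
ghost (the other two kinds of ends are cuts themselves). [folklore] -/
theorem s14_strandEnds_start : ∀ (ι : Literature.Probability.LatticeModels.CollarLegModel.LegInsertionData) (V : Finset (ℤ × ℤ)), ι.IsAdmissible V → (∀ x ∈ insert ι.sink ι.source, ∃ d : ℤ × ℤ, (d = (1, 0) ∨ d = (-1, 0) ∨ d = (0, 1) ∨ d = (0, -1)) ∧ ∀ v : ℤ × ℤ, (v.1 - x.1) ^ 2 + (v.2 - x.2) ^ 2 ≤ ((ι.sinkLegs : ℤ) + 3) ^ 2 → (v ∈ V ↔ 0 ≤ (v.1 - x.1) * d.1 + (v.2 - x.2) * d.2)) → ∀ e ∈ ι.strandEnds V, ¬(ι.model V).IsCut e.1 → ∃ c, (ι.model V).IsCut c ∧ Literature.Probability.LatticeModels.nextCorner ((ι.model V).cfgOf ∅) c = e.1 := by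
  intro ι V hadm hflat e he hn
  obtain ⟨d₀, h, -⟩ := s3_of_admissible ι V hadm
  exact se_start_main ι V hadm h (st := fun t => List.foldl (fun s d => s.step (ι.startAt V d)) ι.init ((cycle V d₀).take t))
    (fun _ => rfl) hflat he hn

/-- **Sub-goal `s14_strandEnds_types`** (registered on stmt-CriticalPhenomena-14132; hypothesis
(E3) of `s14_rainbow_of_valid`): for an admissible leg insertion with flat insertion points, two
distinct strand ends with the same tag are not both cuts (the end created over the sink's
footprint is a cut iff the tag is even, the one over a source's footprint iff it is odd). [folklore] -/
theorem s14_strandEnds_types : ∀ (ι : Literature.Probability.LatticeModels.CollarLegModel.LegInsertionData) (V : Finset (ℤ × ℤ)), ι.IsAdmissible V → (∀ x ∈ insert ι.sink ι.source, ∃ d : ℤ × ℤ, (d = (1, 0) ∨ d = (-1, 0) ∨ d = (0, 1) ∨ d = (0, -1)) ∧ ∀ v : ℤ × ℤ, (v.1 - x.1) ^ 2 + (v.2 - x.2) ^ 2 ≤ ((ι.sinkLegs : ℤ) + 3) ^ 2 → (v ∈ V ↔ 0 ≤ (v.1 - x.1) * d.1 + (v.2 - x.2) * d.2)) → ∀ e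 ∈ ι.strandEnds V, ∀ e' ∈ ι.strandEnds V, e.2 = e'.2 → e.1 ≠ e'.1 → ¬((ι.model V).IsCut e.1 ∧ (ι.model V).IsCut e'.1) := by
  intro ι V hadm hflat e he e' he' htag hne
  obtain ⟨d₀, h, -⟩ := s3_of_admissible ι V hadm
  exact se_types_main ι V hadm h (st := fun t => List.foldl (fun s d => s.step (ι.startAt V d)) ι.init ((cycle V d₀).take t))
    (fun _ => rfl) hflat he he' htag hne

end Summit.CriticalPhenomena.CardyFormulaZ2.Cruxes.BoundaryDefectGaussianR.RainbowMonomialsInExcursionKernels
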